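import Summits.ResolutionOfSingularities.ResolutionOfSingularities.Theorems.FrobeniusLadderFInjectiveMacaulayficationSigma5P2d4CNewtonKFan
import Summits.ResolutionOfSingularities.ResolutionOfSingularities.Theorems.FrobeniusLadderFInjectiveMacaulayficationSigma5P2d4CPointFloor
import Summits.ResolutionOfSingularities.ResolutionOfSingularities.Theorems.FrobeniusLadderFInjectiveMacaulayficationFHalfRowOfWeaklyNondegenerate
import Summits.ResolutionOfSingularities.ResolutionOfSingularities.Theorems.FrobeniusLadderFInjectiveMacaulayficationFHalfRowOfToricCoverData
import Summits.ResolutionOfSingularities.ResolutionOfSingularities.Theorems.FrobeniusLadderFInjectiveMacaulayficationP2d4CSigma5Transport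
import HarnessLib

/-!
# ★★★ THE CLASS-ROUTE RETRO-FIT PILOT CLOSES: `f′ = σ₅(f_P2d4C) = z² + x⁴z + x⁹ + x¹⁰ + y³ + u³ + t³` (char 2) BY THE CLASS THEOREM — the point floor of `V(f′)` is cured
# by the monomial blowing up `𝔪·K` read off the `Σ_f′ ∧ Σ(𝔪)` fan (55 charts), with NO Fedder cell and NO strict-transform table — and, by res-L1-w45a-stub-1ʼs transport along
# `σ₅ : z ↦ z + x⁵` (✓ p680195), THE POINT-FLOOR ROW AND THE GERM ROW OF THE CENSUS BED P2d4C `z² + x⁴z + y³ + u³ + t³` RE-PROVED THROUGH (B″) + TRANSPORT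
# (crux `FInjectiveMacaulayfication` stmt-ResolutionOfSingularities-15315, chain w45a; res-L1-w45a-plan-1 RULING R22.4 (3) «PILOT OF THE CLASS-ROUTE RETRO-FIT — the first census
# bed to be RE-PROVED through (B″)+transport as the cross-certificate of the class route»; seat res-L1-w45a-stub-2 g11; template = res-L1-w45a-stub-3 g12ʼs BED W
# `…P3d4z4557PointFloorRowClass`; transport = res-L1-w45a-stub-1 g13ʼs ✓ p680195 `P2d4CSigma5Transport`)

[OURS · L1 W4.5a] Support file (`--supports stmt-ResolutionOfSingularities-15315 --as helper`); def-free, unconditional; replaces the role of NO printed item;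
NOT a statement of the manuscript; AI-written (AI review is weaker than expert review). One more cross-certificate of census rows, OURS counted 0; nothing of the crux is proved.

`X′ = Spec (k[X₀..X₄]/(f′))`, `f′ = X4 ^ 2 + X0 ^ 4 * X4 + X0 ^ 9 + X0 ^ 10 + X1 ^ 3 + X2 ^ 3 + X3 ^ 3`, `k = k̄` of characteristic 2, `v` = the vertex, floor centre
`𝔪 = (x̄, ȳ, ū, t̄, z̄)`, `A = 𝔪·K` = `genSet 5 Sigma5P2d4CNewtonKFan.AL2` (785 generators, `K` 𝔪-primary, `|K| = 157`; fan `sig5_fan.json` 4f24f39fd1d306c2, certificate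
`sig5_cover.json` 86a530aef7d8e6b6). THEN:
* §0 `exists_refining_strictTransform` — `θ_{V c} f′ = Y^{V c·u₀ c} · g_c`, `g_c(0) ≠ 0` on each of the 55 charts (Newton chart lemma on the tabulated common minimiser);
* §1 `affineBlowup_mK_fullCl_class` — `Bl_{𝔪·K} X′` is FULL at EVERY point (one term on ✓ p656605 §2 `affineBlowup_fullCl_of_weaklyNondegenerate`);
* §2 ★★ `pointFloor_sigma5_row_class` — for EVERY blowing up `g : S′ → Spec 𝒪_{X′,v}` along `𝔪·𝒪_{X′,v}` there is `𝓚 ≠ ⊥` on `S′`, supported over the closed point, ALL of whose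
  blowings up are FULL at every stalk (one term on ✓ p656605 §3 `fHalfRow_of_weaklyNondegenerate`);
* §3 ★★ `f4pos_row_sigma5_class` — conjoined with this seatʼs input side `Sigma5P2d4CPointFloor` (LEGAL, NOT FULL): the two-sided row for `V(f′)` at the point floor;
* §4 ★ `sigma5_fInjectivizationGermAt` — the germ shape `GermForm.FInjectivizationGermAt 2 v` for `V(f′)` (✓ `GermOfGlobalBlowup.fInjectivizationGermAt_of_affineBlowup` on §1);
* §5 ★★★ `pointFloorRow_P2d4C_class` / `p2d4c_fInjectivizationGermAt_class` — THE SAME TWO STATEMENTS FOR THE CENSUS BED P2d4C `f = X4 ^ 2 + X0 ^ 4 * X4 + X1 ^ 3 + X2 ^ 3 + X3 ^ 3`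
  (`k = k̄`, char 2), by res-L1-w45a-stub-1ʼs ✓ p680195 `pointFloorRow_P2d4C_of_sigma5` / `fInjectivizationGermAt_P2d4C_of_sigma5`: a SECOND, independent kernel proof of the germ
  conclusion of ✓ p610550 `P2d4CChar2Germ.p2d4c_bad_germ_row` (there: idea-1ʼs 13-chart toric tower certificate + Fedder cells), and the first P2d4C row at the POINT floor
  (row #1 of the census is at the τ-floor). The only extra hypothesis w.r.t. the cell rows is `k = k̄` (the class theoremʼs standing assumption).
Inputs: `Sigma5P2d4CSpecimen.prime_f` / `regular_off_vertex` / `mk_X_ne_zero` / `weaklyNondegenerate` (✓ p680603), the binders of `Sigma5P2d4CNewtonKFan` (fan side read off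
kernel checks; Newton side `hmin`), `Sigma5P2d4CPointFloor` (input side), ✓ p680195 (transport).
[OURS · certificate instance + assembly of landed theorems] [cite: IshiiSingularities2018, Thm. 4.4.23, Lemma 4.4.24, Cor. 4.4.25 (pp. 95–97)] [cite: StacksProject, Tag 080A]
[cite: GortzWedhorn2020, Prop. 13.91 (2), (13.19)]
-/

-- single-problem summit: the doubled namespace component is forced
set_option linter.dupNamespace false

noncomputable section

open AlgebraicGeometry CategoryTheory Literature.AlgebraicGeometry.Resolution TopologicalSpace IsLocalRing MvPolynomial

namespace Summit.ResolutionOfSingularities.ResolutionOfSingularities.Theorems.FInjectiveMacaulayfication.Sigma5P2d4CPointFloorRowClass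

open Summit.ResolutionOfSingularities.ResolutionOfSingularities.Theorems.FInjectiveMacaulayfication
open SliceableCentre GermForm FanCheckKit Sigma5P2d4CNewtonKFan

/-! ## §0 The refining strict transforms from the Newton minimisers -/

/-- On every chart of the `Σ_f′ ∧ Σ(𝔪)` fan, `θ_{V c} f′ = Y^{V c · u₀ c} · g_c` with `g_c(0) ≠ 0` — the Newton chart lemma on the tabulated common minimiser.
[cite: IshiiSingularities2018, proof of Lemma 4.4.24 (p. 96)] -/
theorem exists_refining_strictTransform (k : Type) [Field k] (f : MvPolynomial (Fin 5) k)
    (hf : f = X 4 ^ 2 + X 0 ^ 4 * X 4 + X 0 ^ 9 + X 0 ^ 10 + X 1 ^ 3 + X 2 ^ 3 + X 3 ^ 3) (c : Fin 55) :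
    ∃ g : MvPolynomial (Fin 5) k, aeval (fun j : Fin 5 => ∏ i : Fin 5, (X i : MvPolynomial (Fin 5) k) ^ Vq c i j) f =
      monomial (Finsupp.equivFunOnFinite.symm ((Vq c).mulVec ⇑(Finsupp.equivFunOnFinite.symm (U0 c) : Fin 5 →₀ ℕ))) 1 * g ∧ constantCoeff g ≠ 0 :=
  NewtonChartLemma.exists_theta_eq_monomial_mul_of_commonMinimiser (Vq c) (hV c) f _ (hu₀ k f hf c) (hmin k f hf c)

/-! ## §1 `Bl_{𝔪·K} X′` is FULL everywhere -/

/-- ★ **`Bl_{𝔪·K} X′` IS FULL AT EVERY POINT** (class route: weak non-degeneracy + Newton fan cover data; no Fedder cell). [OURS · certificate instance]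
[cite: IshiiSingularities2018, Thm. 4.4.23 and Cor. 4.4.25] -/
theorem affineBlowup_mK_fullCl_class (k : Type) [Field k] [IsAlgClosed k] [CharP k 2] (f : MvPolynomial (Fin 5) k)
    (hf : f = X 4 ^ 2 + X 0 ^ 4 * X 4 + X 0 ^ 9 + X 0 ^ 10 + X 1 ^ 3 + X 2 ^ 3 + X 3 ^ 3) :
    ∀ y : ↥(affineBlowup (Ideal.span ((fun e : Fin 5 →₀ ℕ => Ideal.Quotient.mk (Ideal.span {f}) (monomial e (1 : k))) '' (genSet 5 AL2 : Set (Fin 5 →₀ ℕ))))),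
      FullCl 2 ((affineBlowup (Ideal.span ((fun e : Fin 5 →₀ ℕ => Ideal.Quotient.mk (Ideal.span {f}) (monomial e (1 : k))) '' (genSet 5 AL2 : Set (Fin 5 →₀ ℕ))))).presheaf.stalk y) := by
  classical
  haveI : Fact (Nat.Prime 2) := ⟨Nat.prime_two⟩
  choose g hθ hg0 using exists_refining_strictTransform k f hf
  exact FHalfRowOfNewtonNondegenerate.affineBlowup_fullCl_of_weaklyNondegenerate 2 k f (Sigma5P2d4CSpecimen.prime_f k f hf)
    (Sigma5P2d4CSpecimen.weaklyNondegenerate k f hf) (Sigma5P2d4CSpecimen.mk_X_ne_zero k f hf)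
    (fun x hx => Sigma5P2d4CSpecimen.regular_off_vertex k f hf x.asIdeal hx)
    (genSet 5 AL2) hprimAJ.2.1 hprimAJ.1 55 (chartM 5 AL2 CL 55) (hcov k) Vq hV (chartA 5 AL2 CL 55) haA hgen hge g _ hθ hg0 (Sigma5P2d4CNewtonKFan.hv k _)

/-! ## §2 ★★ The cure of the point floor, by the class theorem -/

/-- ★★ **THE POINT FLOOR OF `V(f′)` IS CURED — BY THE CLASS THEOREM** (`k = k̄`, char 2). See the module docstring. [OURS · certificate instance]
[cite: IshiiSingularities2018, Thm. 4.4.23 and Cor. 4.4.25] [cite: StacksProject, Tag 080A] -/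
theorem pointFloor_sigma5_row_class (k : Type) [Field k] [IsAlgClosed k] [CharP k 2] (f : MvPolynomial (Fin 5) k)
    (hf : f = X 4 ^ 2 + X 0 ^ 4 * X 4 + X 0 ^ 9 + X 0 ^ 10 + X 1 ^ 3 + X 2 ^ 3 + X 3 ^ 3)
    (v : Spec (.of (MvPolynomial (Fin 5) k ⧸ Ideal.span {f})))
    (hv : v.asIdeal = Ideal.span (Set.range (fun j : Fin 5 => Ideal.Quotient.mk (Ideal.span {f}) (X j)))) :
    ∀ (S' : Scheme.{0}) (g : S' ⟶ Spec ((Spec (.of (MvPolynomial (Fin 5) k ⧸ Ideal.span {f}))).presheaf.stalk v)),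
      IsBlowup g ((affineBlowup.idealSheaf (Ideal.span (Set.range (fun j : Fin 5 => Ideal.Quotient.mk (Ideal.span {f}) (X j))))).comap
        ((Spec (.of (MvPolynomial (Fin 5) k ⧸ Ideal.span {f}))).fromSpecStalk v)) →
      ∃ 𝓚 : S'.IdealSheafData, 𝓚 ≠ ⊥ ∧
        (∀ s ∈ (𝓚.support : Set S'), g.base s = closedPoint ((Spec (.of (MvPolynomial (Fin 5) k ⧸ Ideal.span {f}))).presheaf.stalk v)) ∧
        ∀ (S'' : Scheme.{0}) (π : S'' ⟶ S'), IsBlowup π 𝓚 → ∀ s : S'', FullCl 2 (S''.presheaf.stalk s) := by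
  classical
  haveI : Fact (Nat.Prime 2) := ⟨Nat.prime_two⟩
  choose g hθ hg0 using exists_refining_strictTransform k f hf
  exact FHalfRowOfNewtonNondegenerate.fHalfRow_of_weaklyNondegenerate 2 k (by norm_num) f (Sigma5P2d4CSpecimen.prime_f k f hf)
    (Sigma5P2d4CSpecimen.weaklyNondegenerate k f hf) (Sigma5P2d4CSpecimen.mk_X_ne_zero k f hf)
    (fun x hx => Sigma5P2d4CSpecimen.regular_off_vertex k f hf x.asIdeal hx)
    (genSet 5 AL2) (genSet 5 KL2) (span_A_eq_floor_mul_K k _).1 hKprim.1 hprimAJ.2.1 hprimAJ.1 55 (chartM 5 AL2 CL 55) (hcov k) Vq hV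
    (chartA 5 AL2 CL 55) haA hgen hge g _ hθ hg0 (Sigma5P2d4CNewtonKFan.hv k _) v hv

/-! ## §3 ★★ The two-sided row for `V(f′)`, by the class route -/

/-- ★★ **THE TWO-SIDED ROW FOR `V(f′)` AT THE POINT FLOOR: LEGAL ∧ NOT F(4)-iso (p = 2) ∧ CURED** (`k = k̄`). The first two conjuncts are this seatʼs `Sigma5P2d4CPointFloor`
(input side), the third is §2. [OURS · assembly of landed theorems] -/
theorem f4pos_row_sigma5_class (k : Type) [Field k] [IsAlgClosed k] [CharP k 2] (f : MvPolynomial (Fin 5) k)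
    (hf : f = X 4 ^ 2 + X 0 ^ 4 * X 4 + X 0 ^ 9 + X 0 ^ 10 + X 1 ^ 3 + X 2 ^ 3 + X 3 ^ 3)
    (v : Spec (.of (MvPolynomial (Fin 5) k ⧸ Ideal.span {f})))
    (hv : v.asIdeal = Ideal.span (Set.range (fun j : Fin 5 => Ideal.Quotient.mk (Ideal.span {f}) (X j))))
    (S' : Scheme.{0}) (g : S' ⟶ Spec ((Spec (.of (MvPolynomial (Fin 5) k ⧸ Ideal.span {f}))).presheaf.stalk v))
    (hg : IsBlowup g ((affineBlowup.idealSheaf (Ideal.span (Set.range (fun j : Fin 5 => Ideal.Quotient.mk (Ideal.span {f}) (X j))))).comap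
      ((Spec (.of (MvPolynomial (Fin 5) k ⧸ Ideal.span {f}))).fromSpecStalk v))) :
    (((affineBlowup.idealSheaf (Ideal.span (Set.range (fun j : Fin 5 => Ideal.Quotient.mk (Ideal.span {f}) (X j))))).comap
        ((Spec (.of (MvPolynomial (Fin 5) k ⧸ Ideal.span {f}))).fromSpecStalk v)) ≠ ⊥ ∧
      (((((affineBlowup.idealSheaf (Ideal.span (Set.range (fun j : Fin 5 => Ideal.Quotient.mk (Ideal.span {f}) (X j))))).comap
        ((Spec (.of (MvPolynomial (Fin 5) k ⧸ Ideal.span {f}))).fromSpecStalk v))).support :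
          Set (Spec ((Spec (.of (MvPolynomial (Fin 5) k ⧸ Ideal.span {f}))).presheaf.stalk v))) ⊆
        (Scheme.regularLocus (Spec ((Spec (.of (MvPolynomial (Fin 5) k ⧸ Ideal.span {f}))).presheaf.stalk v)))ᶜ) ∧
      (∀ s : S', g.base s ≠ closedPoint ((Spec (.of (MvPolynomial (Fin 5) k ⧸ Ideal.span {f}))).presheaf.stalk v) → s ∈ Scheme.regularLocus S') ∧
      (∀ s : S', CMCl (S'.presheaf.stalk s))) ∧
    (∃ s : S', g.base s = closedPoint ((Spec (.of (MvPolynomial (Fin 5) k ⧸ Ideal.span {f}))).presheaf.stalk v) ∧ ¬ FullCl 2 (S'.presheaf.stalk s)) ∧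
    (∃ 𝓚 : S'.IdealSheafData, 𝓚 ≠ ⊥ ∧
      (∀ s ∈ (𝓚.support : Set S'), g.base s = closedPoint ((Spec (.of (MvPolynomial (Fin 5) k ⧸ Ideal.span {f}))).presheaf.stalk v)) ∧
      ∀ (S'' : Scheme.{0}) (π : S'' ⟶ S'), IsBlowup π 𝓚 → ∀ s : S'', FullCl 2 (S''.presheaf.stalk s)) :=
  ⟨Sigma5P2d4CPointFloor.pointFloor_sigma5_input_legal k f hf v hv S' g hg, Sigma5P2d4CPointFloor.pointFloor_sigma5_not_full k f hf v hv S' g hg,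
    pointFloor_sigma5_row_class k f hf v hv S' g hg⟩

/-! ## §4 ★ The germ shape for `V(f′)` -/

/-- ★ **`FInjectivizationGermAt 2 v` AT THE VERTEX OF `V(f′)`** (`k = k̄`, char 2): one `𝔪`-primary monomial blowing up of `Spec 𝒪_{X′,v}` (along `𝔪·K`) is FULL at every stalk
(§1 + ✓ `GermOfGlobalBlowup.fInjectivizationGermAt_of_affineBlowup`). [OURS · certificate instance; cite: GortzWedhorn2020, Prop. 13.91 (2)] -/
theorem sigma5_fInjectivizationGermAt (k : Type) [Field k] [IsAlgClosed k] [CharP k 2] (f : MvPolynomial (Fin 5) k)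
    (hf : f = X 4 ^ 2 + X 0 ^ 4 * X 4 + X 0 ^ 9 + X 0 ^ 10 + X 1 ^ 3 + X 2 ^ 3 + X 3 ^ 3)
    (v : Spec (.of (MvPolynomial (Fin 5) k ⧸ Ideal.span {f})))
    (hv : v.asIdeal = Ideal.span (Set.range (fun j : Fin 5 => Ideal.Quotient.mk (Ideal.span {f}) (X j)))) :
    FInjectivizationGermAt 2 v := by
  classical
  haveI hp : (Ideal.span {f}).IsPrime := Sigma5P2d4CSpecimen.isPrime_span_f k f hf
  haveI : IsDomain (MvPolynomial (Fin 5) k ⧸ Ideal.span {f}) := Ideal.Quotient.isDomain _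
  have hpow : ∀ j : Fin 5, ∃ N : ℕ, (Ideal.Quotient.mk (Ideal.span {f}) (X j)) ^ N ∈
      Ideal.span ((fun e : Fin 5 →₀ ℕ => Ideal.Quotient.mk (Ideal.span {f}) (monomial e (1 : k))) '' (genSet 5 AL2 : Set (Fin 5 →₀ ℕ))) := by
    intro j
    obtain ⟨N, hN⟩ := hprimAJ.2.1 j (Finset.mem_univ j)
    refine ⟨N, ?_⟩
    have e : (Ideal.Quotient.mk (Ideal.span {f}) (X j)) ^ N = Ideal.Quotient.mk (Ideal.span {f}) (monomial (Finsupp.single j N) (1 : k)) := by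
      rw [← map_pow, X_pow_eq_monomial]
    rw [e]
    exact Ideal.subset_span ⟨_, Finset.mem_coe.mpr hN, rfl⟩
  refine GermOfGlobalBlowup.fInjectivizationGermAt_of_affineBlowup 2 _ ?_ v ?_ (affineBlowup_mK_fullCl_class k f hf)
  · obtain ⟨N, hN⟩ := hpow 0
    intro hbot
    rw [hbot, Ideal.mem_bot] at hN
    exact pow_ne_zero N (Sigma5P2d4CSpecimen.mk_X_ne_zero k f hf 0) hN
  · rw [hv, Ideal.span_le]
    rintro _ ⟨j, rfl⟩
    obtain ⟨N, hN⟩ := hpow j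
    exact ⟨N, hN⟩

/-! ## §5 ★★★ TRANSPORT TO THE CENSUS BED P2d4C (res-L1-w45a-stub-1ʼs ✓ p680195) -/

/-- ★★★ **THE POINT-FLOOR ROW OF P2d4C `z² + x⁴z + y³ + u³ + t³` (char 2, `k = k̄`) — LEGAL ∧ NOT F(4)-iso ∧ CURED — RE-PROVED THROUGH THE CLASS ROUTE**: §3 for `f′ = σ₅ f` transported along
`σ₅ : z ↦ z + x⁵` by res-L1-w45a-stub-1ʼs ✓ p680195 `P2d4CSigma5Transport.pointFloorRow_P2d4C_of_sigma5`. [OURS · assembly of landed theorems; cite: GortzWedhorn2020, (13.19)] -/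
theorem pointFloorRow_P2d4C_class (k : Type) [Field k] [IsAlgClosed k] [CharP k 2] (f : MvPolynomial (Fin 5) k)
    (hf : f = X 4 ^ 2 + X 0 ^ 4 * X 4 + X 1 ^ 3 + X 2 ^ 3 + X 3 ^ 3) :
    ∀ (v' : Spec (.of (MvPolynomial (Fin 5) k ⧸ Ideal.span {f}))),
      v'.asIdeal = Ideal.span (Set.range fun j : Fin 5 => Ideal.Quotient.mk (Ideal.span {f}) (X j)) →
      ∀ (S' : Scheme.{0}) (g₁ : S' ⟶ Spec ((Spec (.of (MvPolynomial (Fin 5) k ⧸ Ideal.span {f}))).presheaf.stalk v')),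
        IsBlowup g₁ ((affineBlowup.idealSheaf (Ideal.span (Set.range fun j : Fin 5 => Ideal.Quotient.mk (Ideal.span {f}) (X j)))).comap
          ((Spec (.of (MvPolynomial (Fin 5) k ⧸ Ideal.span {f}))).fromSpecStalk v')) →
        (((affineBlowup.idealSheaf (Ideal.span (Set.range fun j : Fin 5 => Ideal.Quotient.mk (Ideal.span {f}) (X j)))).comap
            ((Spec (.of (MvPolynomial (Fin 5) k ⧸ Ideal.span {f}))).fromSpecStalk v')) ≠ ⊥ ∧
          ((((affineBlowup.idealSheaf (Ideal.span (Set.range fun j : Fin 5 => Ideal.Quotient.mk (Ideal.span {f}) (X j)))).comap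
            ((Spec (.of (MvPolynomial (Fin 5) k ⧸ Ideal.span {f}))).fromSpecStalk v')).support :
              Set (Spec ((Spec (.of (MvPolynomial (Fin 5) k ⧸ Ideal.span {f}))).presheaf.stalk v'))) ⊆
            (Scheme.regularLocus (Spec ((Spec (.of (MvPolynomial (Fin 5) k ⧸ Ideal.span {f}))).presheaf.stalk v')))ᶜ) ∧
          (∀ s : S', g₁.base s ≠ closedPoint _ → s ∈ Scheme.regularLocus S') ∧ (∀ s : S', CMCl (S'.presheaf.stalk s))) ∧
        (∃ s : S', g₁.base s = closedPoint _ ∧ ¬ FullCl 2 (S'.presheaf.stalk s)) ∧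
        (∃ 𝓚 : S'.IdealSheafData, 𝓚 ≠ ⊥ ∧ (∀ s ∈ (𝓚.support : Set S'), g₁.base s = closedPoint _) ∧
          ∀ (S'' : Scheme.{0}) (π : S'' ⟶ S'), IsBlowup π 𝓚 → ∀ s : S'', FullCl 2 (S''.presheaf.stalk s)) :=
  P2d4CSigma5Transport.pointFloorRow_P2d4C_of_sigma5 k 2 f _ hf rfl (fun v hv S' g₁ hg₁ => f4pos_row_sigma5_class k _ rfl v hv S' g₁ hg₁)

/-- ★★★ **`FInjectivizationGermAt 2 v` AT THE VERTEX OF P2d4C, BY THE CLASS ROUTE** (`k = k̄`, char 2): §4 for `f′` transported by ✓ p680195 `fInjectivizationGermAt_P2d4C_of_sigma5` —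
a second, independent kernel proof of the germ conclusion of ✓ p610550 `P2d4CChar2Germ.p2d4c_bad_germ_row`. [OURS · assembly of landed theorems; cite: GortzWedhorn2020, (13.19)] -/
theorem p2d4c_fInjectivizationGermAt_class (k : Type) [Field k] [IsAlgClosed k] [CharP k 2] (f : MvPolynomial (Fin 5) k)
    (hf : f = X 4 ^ 2 + X 0 ^ 4 * X 4 + X 1 ^ 3 + X 2 ^ 3 + X 3 ^ 3) :
    ∀ v' : Spec (.of (MvPolynomial (Fin 5) k ⧸ Ideal.span {f})),
      v'.asIdeal = Ideal.span (Set.range fun j : Fin 5 => Ideal.Quotient.mk (Ideal.span {f}) (X j)) → FInjectivizationGermAt 2 v' :=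
  P2d4CSigma5Transport.fInjectivizationGermAt_P2d4C_of_sigma5 k 2 f _ hf rfl (fun v hv => sigma5_fInjectivizationGermAt k _ rfl v hv)

end Summit.ResolutionOfSingularities.ResolutionOfSingularities.Theorems.FInjectiveMacaulayfication.Sigma5P2d4CPointFloorRowClass

end
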